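import Literature.Geometry.Lorentzian.LevelCurveGeodesicCurvature
import Literature.Geometry.Lorentzian.Stationary

/-!
# Calculus along a confined geodesic (helper file for the crux `ErgoregionBombModT`,
# stmt-FinalStateConjecture-17838, line SketchIdeator4, registered stub G12)

On a stationary asymptotically flat black hole `𝓑` (`Literature.Geometry.Lorentzian.StationaryAFBlackHole`)
with its Levi-Civita connection, for a function `F` of class `C²` on an open set `W`:

* along a geodesic `γ` of `𝓑.metric` on a parameter set `s` with `γ '' s ⊆ W`, the function
  `φ = F ∘ γ` has derivative `dF(γ̇)` and `t ↦ dF_{γ t}(γ̇ t)` has derivative `Hess F(γ̇, γ̇)` at every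
  `t ∈ s` — O'Neill 1983, Ch. 3, Lemma 3.49, `(f ∘ γ)'' = Hess f(γ', γ') + df(D_t γ')`
  (tree: `PseudoRiemannianMetric.hasDerivAt_mvfderiv_velocity`), with the geodesic equation
  `D_t γ' = 0` killing the second summand, and the chain rule `hasDerivAt_comp_curve` for the first
  derivative;
* a function which is constant along the whole-line integral curves of the Killing field `T = 𝓑.killing`
  issued from a compact `S ⊆ W` is bounded on the cage `⋃ₜ φₜ(S) = stationaryOrbit 𝓑.killing S`
  (continuity of `F` on the compact `S`).

This is the statement `stub_calculusAlongGeodesic` registered by the line skeleton, proved verbatim.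

## References

* B. O'Neill, *Semi-Riemannian geometry with applications to relativity*, Academic Press 1983,
  Ch. 3, Def. 3.48–Lemma 3.49.
-/

noncomputable section

set_option linter.dupNamespace false

namespace Summit.FinalStateConjecture.FinalStateConjecture.Theorems.ErgoregionBombModT

open Set Bundle Literature.Geometry.Lorentzian
open scoped Manifold ContDiff Topology

/-- **G12 (calculus along the confined geodesic).** For a geodesic `γ` of `𝓑.metric` on a parameter
set `s` running in an open set `W` on which `F` is `C²`: `F ∘ γ` has derivative `dF(γ̇)` and
`t ↦ dF(γ̇ t)` has derivative `Hess F(γ̇, γ̇)` on `s` (O'Neill 1983, Ch. 3, Lemma 3.49,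
`(F ∘ γ)'' = Hess F(γ̇, γ̇) + dF(D_t γ̇)`, with the geodesic equation `D_t γ̇ = 0`; tree
`PseudoRiemannianMetric.hasDerivAt_mvfderiv_velocity` and `hasDerivAt_comp_curve`); and a function
constant along the integral curves of `T = 𝓑.killing` issued from a compact `S ⊆ W` (where `F` is
continuous) is bounded on the cage `⋃ₜ φₜ(S)` (`IsCompact.exists_bound_of_continuousOn`). -/
theorem stub_calculusAlongGeodesic :
    ∀ (𝓑 : StationaryAFBlackHole.{0}) [𝓑.metric.HasLeviCivita] (W : Set 𝓑.carrier) (F : 𝓑.carrier → ℝ),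
      IsOpen W → ContMDiffOn (𝓡 4) 𝓘(ℝ, ℝ) 2 F W →
      (∀ (γ : ℝ → 𝓑.carrier) (s : Set ℝ),
        IsGeodesicOn 𝓑.metric.toPseudoRiemannianMetric.leviCivita γ s → (∀ t ∈ s, γ t ∈ W) → ∀ t ∈ s,
          HasDerivAt (fun t ↦ F (γ t)) (mvfderiv (𝓡 4) F (γ t) (velocity (𝓡 4) γ t)) t ∧
          HasDerivAt (fun t ↦ mvfderiv (𝓡 4) F (γ t) (velocity (𝓡 4) γ t))
            (𝓑.metric.toPseudoRiemannianMetric.hessian F (γ t) (velocity (𝓡 4) γ t) (velocity (𝓡 4) γ t)) t) ∧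
      (∀ S : Set 𝓑.carrier, IsCompact S → S ⊆ W →
        (∀ σ : ℝ → 𝓑.carrier, IsMIntegralCurve σ 𝓑.killing → σ 0 ∈ S → ∀ t, F (σ t) = F (σ 0)) →
        ∃ M : ℝ, ∀ x ∈ stationaryOrbit 𝓑.killing S, |F x| ≤ M) := by
  intro 𝓑 _ W F hW hF
  refine ⟨fun γ s hγ hγW t ht ↦ ?_, fun S hS hSW hinv ↦ ?_⟩
  · -- `F` is `C²` at `γ t ∈ W` (`W` open) and `γ` is differentiable at `t ∈ s`
    have hFt : ContMDiffAt (𝓡 4) 𝓘(ℝ, ℝ) 2 F (γ t) := hF.contMDiffAt (hW.mem_nhds (hγW t ht))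
    have hγd : MDifferentiableAt 𝓘(ℝ, ℝ) (𝓡 4) γ t := IsGeodesicOn.mdifferentiableAt_holds hγ ht
    refine ⟨hasDerivAt_comp_curve (hFt.mdifferentiableAt two_ne_zero) hγd, ?_⟩
    -- O'Neill, Lemma 3.49: `(dF(γ̇))' = Hess F(γ̇, γ̇) + dF(D_t γ̇)`, and `D_t γ̇ = 0`
    have h := 𝓑.metric.toPseudoRiemannianMetric.hasDerivAt_mvfderiv_velocity hFt (hγ.1 t ht)
    rw [hγ.2 t ht, map_zero, add_zero] at h
    exact h
  · -- `F` is continuous on the compact `S`, hence bounded there; invariance transports the bound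
    obtain ⟨M, hM⟩ := hS.exists_bound_of_continuousOn (hF.continuousOn.mono hSW)
    refine ⟨M, ?_⟩
    rintro x ⟨σ, hσ, h0, t, rfl⟩
    rw [hinv σ hσ h0 t, ← Real.norm_eq_abs]
    exact hM (σ 0) h0

end Summit.FinalStateConjecture.FinalStateConjecture.Theorems.ErgoregionBombModT

end
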